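import Mathlib
import Literature.AlgebraicGeometry.Resolution.PolygonPointSetInvariants
import HarnessLib

/-!
# The polygon `Δ(f, y, u)` of a SYSTEM `f = (f₁, …, f_m)` with multiplicities `nᵢ`, from the per-generator engine (CJS Def. 8.5, Lemma 8.6)

Topic: `Literature/AlgebraicGeometry/Resolution`. Cossart–Jannsen–Saito, LNM 2270, Def. 8.5 (1): «the polyhedron `Δ((f₁,…,f_m), y, u)` … is the smallest F-subset
containing `⋃ᵢ Δ(fᵢ, y, u)`»; (3): `δ_L(f, y, u) = min{δ_L(fᵢ, y, u)}`; Lemma 8.6: the essential points lie in `(1/d!) ℤ^e`, `d = max n_(u)(fᵢ)`. In the tree's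
expansion-free engine the polygon of ONE generator is that of the idealistic exponent `(span{fᵢ}, nᵢ)` (`PolygonInvariantsIndexed.pts`, scaled by `nᵢ!`; memo
`run/shared/lean/pub/res-hironaka/L/res-L1-w42-stub-3/KEYCLAIM-PORT-PLAN.md` §6.2′), so the system's scaled point set is the union over `i` of the per-generator
scaled Newton points brought to the common denominator `d!` (`rescale d nᵢ = d!/nᵢ!`). PROVED (ns `WeightedOrder`; no facts):

* `rescale`, `rescale_pos`, `factorial_mul_rescale`; `sptSetF c f n d s = ⋃_{i ∈ s} (d!/nᵢ!) · sptSet c (span{fᵢ}) nᵢ`, `sptSetF_nonempty`;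
* `deltaP_biUnion`, `alphaP_biUnion`, `epsP_biUnion` — over a finite union of nonempty point sets `δ, α, ε` are the minima (Def. 8.5 (3)); hence
  `deltaP_sptSetF`, `alphaP_sptSetF`, `epsP_sptSetF`: **`δ(f) = minᵢ (d!/nᵢ!) δs(fᵢ)`, `α(f) = minᵢ (d!/nᵢ!) αs(fᵢ)`, `ε(f) = minᵢ (d!/nᵢ!) εs(fᵢ)`**;
* `colon_map_span_singleton_eq_span` — in an integral chart ring the engine's weak transform of a principal ideal is principal:
  `((span{g}) R′ : x) = span{g′}` when `φ g = x g′`, `x ≠ 0` (so the per-generator transforms `fᵢ′ = fᵢ/u₁^{nᵢ}` of CJS are the engine's colon ideals).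

Sources: V. Cossart, U. Jannsen, S. Saito, LNM **2270** (2020), Def. 8.5, Lemma 8.6, Def. 11.1 [`CossartJannsenSaito2020`]; H. Hironaka, J. Math. Kyoto Univ. 7 (1967), §3
[`Hironaka1967`]. AI-written; weaker than expert review. No named facts; no instance, notation or attribute.
-/

noncomputable section

open IsLocalRing

namespace Literature.AlgebraicGeometry.Resolution

namespace WeightedOrder

universe u

/-! ## Finite unions of point sets -/

section BiUnion

variable {ι : Type*} (S : ι → Set (ℕ × ℕ))

/-- A finite union of nonempty point sets over a nonempty index set is nonempty. [cite: CossartJannsenSaito2020, Def. 8.5 (1)] -/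
theorem biUnion_nonempty {s : Finset ι} (hs : s.Nonempty) (hS : ∀ i ∈ s, (S i).Nonempty) : (⋃ i ∈ s, S i).Nonempty := by
  obtain ⟨i, hi⟩ := hs
  obtain ⟨p, hp⟩ := hS i hi
  exact ⟨p, Set.mem_biUnion hi hp⟩

/-- Generic: an invariant that is a minimum over binary unions is the `inf'` over finite unions. [cite: CossartJannsenSaito2020, Def. 8.5 (3)] -/
theorem biUnion_eq_inf' (g : Set (ℕ × ℕ) → ℕ)
    (hg : ∀ A B : Set (ℕ × ℕ), A.Nonempty → B.Nonempty → g (A ∪ B) = min (g A) (g B))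
    {s : Finset ι} (hs : s.Nonempty) (hS : ∀ i ∈ s, (S i).Nonempty) : g (⋃ i ∈ s, S i) = s.inf' hs fun i => g (S i) := by
  induction hs using Finset.Nonempty.cons_induction with
  | singleton a => simp
  | cons a s ha hs ih =>
    have hS' : ∀ i ∈ s, (S i).Nonempty := fun i hi => hS i (Finset.mem_cons_of_mem hi)
    have hU : (⋃ i ∈ Finset.cons a s ha, S i) = S a ∪ ⋃ i ∈ s, S i := by
      ext p
      simp only [Set.mem_iUnion, Finset.mem_cons, Set.mem_union, exists_prop]
      constructor
      · rintro ⟨i, rfl | hi, hp⟩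
        · exact Or.inl hp
        · exact Or.inr ⟨i, hi, hp⟩
      · rintro (hp | ⟨i, hi, hp⟩)
        · exact ⟨a, Or.inl rfl, hp⟩
        · exact ⟨i, Or.inr hi, hp⟩
    rw [hU, hg _ _ (hS a (Finset.mem_cons_self a s)) (biUnion_nonempty S hs hS'), ih hS', Finset.inf'_cons hs]

/-- **`δ` of a finite union is the minimum** (CJS Def. 8.5 (3)). [cite: CossartJannsenSaito2020, Def. 8.5 (3)] -/
theorem deltaP_biUnion {s : Finset ι} (hs : s.Nonempty) (hS : ∀ i ∈ s, (S i).Nonempty) :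
    deltaP (⋃ i ∈ s, S i) = s.inf' hs fun i => deltaP (S i) :=
  biUnion_eq_inf' S deltaP (fun _ _ hA hB => deltaP_union hA hB) hs hS

/-- **`α` of a finite union is the minimum.** [cite: CossartJannsenSaito2020, Def. 8.5 (3), Def. 11.1] -/
theorem alphaP_biUnion {s : Finset ι} (hs : s.Nonempty) (hS : ∀ i ∈ s, (S i).Nonempty) :
    alphaP (⋃ i ∈ s, S i) = s.inf' hs fun i => alphaP (S i) :=
  biUnion_eq_inf' S alphaP (fun _ _ hA hB => alphaP_union hA hB) hs hS

/-- **`ε` of a finite union is the minimum.** [cite: CossartJannsenSaito2020, Def. 8.5 (3), Def. 11.1] -/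
theorem epsP_biUnion {s : Finset ι} (hs : s.Nonempty) (hS : ∀ i ∈ s, (S i).Nonempty) :
    epsP (⋃ i ∈ s, S i) = s.inf' hs fun i => epsP (S i) :=
  biUnion_eq_inf' S epsP (fun _ _ hA hB => epsP_union hA hB) hs hS

end BiUnion

/-! ## The system polygon -/

section System

variable {R : Type u} [CommRing R] {r : ℕ} (c : Fin (r + 2) → R) {ι : Type*} (f : ι → R) (n : ι → ℕ) (d : ℕ)

/-- The rescaling factor `d!/m!` from the denominator `m!` of one generator to the common `d!`. [cite: CossartJannsenSaito2020, Lemma 8.6] -/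
def rescale (d m : ℕ) : ℕ := d.factorial / m.factorial

/-- `m! · (d!/m!) = d!` for `m ≤ d`. [cite: CossartJannsenSaito2020, Lemma 8.6] -/
theorem factorial_mul_rescale {d m : ℕ} (h : m ≤ d) : m.factorial * rescale d m = d.factorial :=
  Nat.mul_div_cancel' (Nat.factorial_dvd_factorial h)

/-- The rescaling factor is positive for `m ≤ d`. [cite: CossartJannsenSaito2020, Lemma 8.6] -/
theorem rescale_pos {d m : ℕ} (h : m ≤ d) : 0 < rescale d m := by
  have := factorial_mul_rescale h
  rcases Nat.eq_zero_or_pos (rescale d m) with h0 | h0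
  · rw [h0, mul_zero] at this; exact absurd this.symm (Nat.factorial_pos d).ne'
  · exact h0

/-- **The scaled point set of the system `(fᵢ, nᵢ)_{i ∈ s}`** at the common denominator `d!`: the union of the per-generator scaled Newton point sets
`sptSet c (span{fᵢ}) nᵢ` rescaled by `d!/nᵢ!`. Its F-hull is `d! · Δ(f, y, u)`. [cite: CossartJannsenSaito2020, Def. 8.5 (1), Lemma 8.6] -/
def sptSetF (s : Finset ι) : Set (ℕ × ℕ) := ⋃ i ∈ s, scalePt (rescale d (n i)) '' sptSet c (Ideal.span {f i}) (n i)

/-- The system point set is nonempty as soon as one generator has a Newton point. [cite: CossartJannsenSaito2020, Def. 8.5 (1)] -/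
theorem sptSetF_nonempty {s : Finset ι} {i : ι} (hi : i ∈ s) (h : (pts c (Ideal.span {f i}) (n i)).Nonempty) : (sptSetF c f n d s).Nonempty := by
  obtain ⟨p, hp⟩ := ((sptSet_nonempty_iff c _ _).mpr h).image (scalePt (rescale d (n i)))
  exact ⟨p, Set.mem_biUnion (t := fun i => scalePt (rescale d (n i)) '' sptSet c (Ideal.span {f i}) (n i)) hi hp⟩

variable {c f n d}

/-- **`δ(f) = minᵢ (d!/nᵢ!) · δs(fᵢ)`** over the generators with Newton points (all of `s` here). [cite: CossartJannsenSaito2020, Def. 8.5 (3)] -/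
theorem deltaP_sptSetF {s : Finset ι} (hs : s.Nonempty) (hS : ∀ i ∈ s, (pts c (Ideal.span {f i}) (n i)).Nonempty) :
    deltaP (sptSetF c f n d s) = s.inf' hs fun i => rescale d (n i) * deltaS c (Ideal.span {f i}) (n i) := by
  rw [sptSetF, deltaP_biUnion _ hs fun i hi => ((sptSet_nonempty_iff c _ _).mpr (hS i hi)).image _]
  refine Finset.inf'_congr hs rfl fun i _ => ?_
  rw [deltaP_scale, deltaS_eq_deltaP]

/-- **`α(f) = minᵢ (d!/nᵢ!) · αs(fᵢ)`.** [cite: CossartJannsenSaito2020, Def. 8.5 (3), Def. 11.1] -/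
theorem alphaP_sptSetF {s : Finset ι} (hs : s.Nonempty) (hS : ∀ i ∈ s, (pts c (Ideal.span {f i}) (n i)).Nonempty) :
    alphaP (sptSetF c f n d s) = s.inf' hs fun i => rescale d (n i) * alphaS c (Ideal.span {f i}) (n i) := by
  rw [sptSetF, alphaP_biUnion _ hs fun i hi => ((sptSet_nonempty_iff c _ _).mpr (hS i hi)).image _]
  refine Finset.inf'_congr hs rfl fun i _ => ?_
  rw [alphaP_scale, alphaS_eq_alphaP]

/-- **`ε(f) = minᵢ (d!/nᵢ!) · εs(fᵢ)`.** [cite: CossartJannsenSaito2020, Def. 8.5 (3), Def. 11.1] -/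
theorem epsP_sptSetF {s : Finset ι} (hs : s.Nonempty) (hS : ∀ i ∈ s, (pts c (Ideal.span {f i}) (n i)).Nonempty) :
    epsP (sptSetF c f n d s) = s.inf' hs fun i => rescale d (n i) * epsS c (Ideal.span {f i}) (n i) := by
  rw [sptSetF, epsP_biUnion _ hs fun i hi => ((sptSet_nonempty_iff c _ _).mpr (hS i hi)).image _]
  refine Finset.inf'_congr hs rfl fun i _ => ?_
  rw [epsP_scale, epsS_eq_epsP]

end System

/-! ## The weak transform of one generator is the engine's colon ideal -/

section Colon

variable {R R' : Type u} [CommRing R] [CommRing R'] [IsDomain R'] (φ : R →+* R')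

/-- **`((span{g}) R′ : x) = span{g′}` when `φ g = x · g′` and `x ≠ 0`** (integral chart ring): the weak transform `fᵢ′ = fᵢ/u₁^{nᵢ}` of one member of a
standard basis (CJS Ch. 8–9) is the colon ideal the engine's chart laws are stated for. [cite: CossartJannsenSaito2020, Def. 8.5] [cite: Hironaka1967, §3] -/
theorem colon_map_span_singleton_eq_span {g : R} {x g' : R'} (hx : x ≠ 0) (hg : φ g = x * g') :
    ((Ideal.span {g}).map φ).colon {x} = Ideal.span {g'} := by
  rw [Ideal.map_span, Set.image_singleton, hg]
  ext h
  rw [Submodule.mem_colon_singleton, smul_eq_mul, Ideal.mem_span_singleton, Ideal.mem_span_singleton]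
  constructor
  · rintro ⟨a, ha⟩
    refine ⟨a, mul_left_cancel₀ hx ?_⟩
    calc x * h = h * x := mul_comm _ _
      _ = x * g' * a := ha
      _ = x * (g' * a) := by ring
  · rintro ⟨a, rfl⟩
    exact ⟨a, by ring⟩

end Colon

end WeightedOrder

end Literature.AlgebraicGeometry.Resolution

end
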